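import Mathlib
import Literature.Probability.Percolation.SmoothedWhiteNoise
import Literature.Probability.Percolation.KSTPeriodicDefs
import Literature.Probability.Percolation.KSTPeriodicSymmetry
import Literature.Probability.Percolation.KSTPeriodicDualMeasure
import Literature.Probability.Percolation.BondPercolationSymmetry
import Literature.Probability.Percolation.CylinderLoops
import Summits.CriticalPhenomena.CardyFormulaZ2.Theorems.CardyWhiteToColouredNoiseDiscretisationSignMeasurable

/-!
# Stub stub_signLawInvariant — lattice symmetries of the sign law (line `birth` of crux `DriftBound`)

Helper file for crux item `DriftBound` (stmt-CriticalPhenomena-4596) of route `CardyWhiteToColoured`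
(`CardyFormulaZ2`), stub S12 of the registered line `Cruxes/DriftBound/Lines/birth.lean` (skeleton
v3): the three symmetry fields of `KSTPeriodic.Admissible 1 0` for the law `signConfigLaw σ 1` of
the sign configuration `{e ∈ E(ℤ²) | (k_σ ⋆ ξ)(m_1 e) > 0}` of the Gaussian-smoothed lattice white
noise (`ξ` i.i.d. `N(0,1)` on the edges of `ℤ²`, sitting at the medial points `m_1(e)`).

The proof is one generic lemma applied three times. Let `g` be a bijection of `ℤ²` which

* preserves adjacency (so `e ↦ g e := Sym2.map g e` restricts to a bijection `ĝ` of `E(ℤ²)`,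
  `KSTPeriodic.map_mem_edgeSet_iff`), and
* moves medial points isometrically, `|m(g e) − m(g e')| = |m e − m e'|`.

Then, for every noise `ξ` (summable or not — the two unconditional sums agree termwise after
reindexing by `ĝ`, `Equiv.tsum_eq`), `(k_σ ⋆ (ξ ∘ ĝ⁻¹))(m(g e)) = (k_σ ⋆ ξ)(m e)`, hence
`g • signConfig σ 1 ξ = signConfig σ 1 (ξ ∘ ĝ⁻¹)` pointwise; and `ξ ↦ ξ ∘ ĝ⁻¹` preserves the product
measure `latticeWhiteNoise = ⨂_e N(0,1)` (Mathlib's `Measure.map_infinitePi_infinitePi_of_inj`).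
So `g_* signConfigLaw σ 1 = signConfigLaw σ 1`. The translations `x ↦ x + v` (medial points move by
`δ v`, `medialPoint_map_shift`), the transposition `(x₀, x₁) ↦ (x₁, x₀)` (medial points move by
`z ↦ i z̄`) and the reflections `x ↦ (−t − x₀, x₁)` (medial points move by `z ↦ −z̄ − δ t`) are such
bijections (`zdGraph_adj_shift_iff`, `KSTPeriodic.transposeEquiv_adj_iff`,
`KSTPeriodic.flipEquiv_adj_iff`).

References: L. Köhler-Schindler, V. Tassion, Duke Math. J. 172 (2023), §1 (symmetries);
S. Muirhead, H. Vanneuville, Ann. Inst. H. Poincaré Probab. Stat. 56 (2020), §2.1;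
G. Grimmett, *Percolation* (1999), §1.6 (invariance of product measures under relabelling).
-/

noncomputable section

namespace Summit.CriticalPhenomena.CardyFormulaZ2.Cruxes.DriftBound.Birth

open Set MeasureTheory ProbabilityTheory
open scoped ComplexConjugate
open Literature.Probability.LatticeModels Literature.Probability.Percolation
open Summit.CriticalPhenomena.CardyFormulaZ2.Theorems.WhiteToColoured

/-! ### Transport of the smoothed field and of the sign configuration -/

/-- Reindexing a weighted series of the noise by a bijection `τ` of the index set:
`∑ a_i ξ_{τ⁻¹ i} = ∑ b_i ξ_i` as soon as `a_{τ i} = b_i` (unconditional sums, no summability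
needed: the two families agree termwise after reindexing, `Equiv.tsum_eq`). -/
theorem inv_tsum_reindex {ι : Type*} (τ : ι ≃ ι) (a b ξ : ι → ℝ) (h : ∀ i, a (τ i) = b i) :
    ∑' i, a i * ξ (τ.symm i) = ∑' i, b i * ξ i :=
  calc ∑' i, a i * ξ (τ.symm i) = ∑' i, a (τ i) * ξ (τ.symm (τ i)) :=
        (Equiv.tsum_eq τ (fun i => a i * ξ (τ.symm i))).symm
    _ = ∑' i, b i * ξ i := tsum_congr fun i => by rw [h, Equiv.symm_apply_apply]

/-- **Transport of the smoothed field.** Let `g` be a bijection of `ℤ²` moving medial points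
isometrically and `τ` a bijection of the edge set acting on pairs by `Sym2.map g`. Relabelling
the noise by `τ⁻¹` transports the smoothed field: `F(ξ ∘ τ⁻¹)(m(g e)) = F(ξ)(m e)` for every
noise `ξ` (the Gaussian weights `exp(−|m(g e) − m(g e')|²/(2ℓ²)) = exp(−|m e − m e'|²/(2ℓ²))`
agree termwise). -/
theorem inv_smoothedNoise_comp (ℓ δ : ℝ) (g : Site 2 ≃ Site 2)
    (hiso : ∀ e e' : Sym2 (Site 2),
      ‖medialPoint δ (Sym2.map g e) - medialPoint δ (Sym2.map g e')‖ =
        ‖medialPoint δ e - medialPoint δ e'‖)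
    (τ : (zdGraph 2).edgeSet ≃ (zdGraph 2).edgeSet)
    (hτ : ∀ e : (zdGraph 2).edgeSet, ((τ e : (zdGraph 2).edgeSet) : Sym2 (Site 2)) = Sym2.map g e.1)
    (ξ : (zdGraph 2).edgeSet → ℝ) (e : Sym2 (Site 2)) :
    smoothedNoise ℓ δ (ξ ∘ τ.symm) (medialPoint δ (Sym2.map g e)) =
      smoothedNoise ℓ δ ξ (medialPoint δ e) := by
  have h := inv_tsum_reindex τ
    (fun e' : (zdGraph 2).edgeSet =>
      Real.exp (-(‖medialPoint δ (Sym2.map g e) - medialPoint δ e'.1‖ ^ 2) / (2 * ℓ ^ 2)))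
    (fun e' : (zdGraph 2).edgeSet =>
      Real.exp (-(‖medialPoint δ e - medialPoint δ e'.1‖ ^ 2) / (2 * ℓ ^ 2)))
    ξ (fun e' => by rw [hτ, hiso])
  simpa only [smoothedNoise, Function.comp_apply] using h

/-- **Equivariance of the sign configuration.** If moreover `g` preserves adjacency, acting by `g`
on the sign configuration of `ξ` gives the sign configuration of the relabelled noise `ξ ∘ τ⁻¹`,
for every `ξ`. -/
theorem inv_act_signConfig (ℓ δ : ℝ) (g : Site 2 ≃ Site 2)
    (hadj : ∀ x y, (zdGraph 2).Adj (g x) (g y) ↔ (zdGraph 2).Adj x y)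
    (hiso : ∀ e e' : Sym2 (Site 2),
      ‖medialPoint δ (Sym2.map g e) - medialPoint δ (Sym2.map g e')‖ =
        ‖medialPoint δ e - medialPoint δ e'‖)
    (τ : (zdGraph 2).edgeSet ≃ (zdGraph 2).edgeSet)
    (hτ : ∀ e : (zdGraph 2).edgeSet, ((τ e : (zdGraph 2).edgeSet) : Sym2 (Site 2)) = Sym2.map g e.1)
    (ξ : (zdGraph 2).edgeSet → ℝ) :
    KST2023.act g (signConfig ℓ δ ξ) = signConfig ℓ δ (ξ ∘ τ.symm) := by
  ext z
  obtain ⟨z, rfl⟩ := (sym2Equiv g).surjective z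
  rw [BondConfig.mem_relabel_iff, Equiv.symm_apply_apply, mem_signConfig_iff, mem_signConfig_iff,
    sym2Equiv_apply, KSTPeriodic.map_mem_edgeSet_iff hadj,
    inv_smoothedNoise_comp ℓ δ g hiso τ hτ ξ z]

/-- **Invariance of the sign law under an isometric lattice symmetry.** If the bijection `g` of
`ℤ²` preserves adjacency and moves medial points isometrically, then the law of the sign
configuration is invariant under the action of `g` on bond configurations: with `ĝ` the induced
bijection of the edge set, the relabelling `ξ ↦ ξ ∘ ĝ⁻¹` preserves the i.i.d. Gaussian product
measure and intertwines `signConfig` with the action of `g`. -/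
theorem inv_signConfigLaw_map_act (ℓ δ : ℝ) (g : Site 2 ≃ Site 2)
    (hadj : ∀ x y, (zdGraph 2).Adj (g x) (g y) ↔ (zdGraph 2).Adj x y)
    (hiso : ∀ e e' : Sym2 (Site 2),
      ‖medialPoint δ (Sym2.map g e) - medialPoint δ (Sym2.map g e')‖ =
        ‖medialPoint δ e - medialPoint δ e'‖) :
    (signConfigLaw ℓ δ).map (KST2023.act g) = signConfigLaw ℓ δ := by
  -- the induced bijection `ĝ` of the edge set (as a subtype)
  obtain ⟨τ, hτ⟩ : ∃ τ : (zdGraph 2).edgeSet ≃ (zdGraph 2).edgeSet,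
      ∀ e : (zdGraph 2).edgeSet, ((τ e : (zdGraph 2).edgeSet) : Sym2 (Site 2)) = Sym2.map g e.1 :=
    ⟨(sym2Equiv g).subtypeEquiv fun z => (KSTPeriodic.map_mem_edgeSet_iff hadj z).symm,
      fun _ => rfl⟩
  have hmeas : Measurable fun ξ : (zdGraph 2).edgeSet → ℝ => ξ ∘ τ.symm :=
    measurable_pi_lambda _ fun i => measurable_pi_apply (τ.symm i)
  have hcomp : (KST2023.act g) ∘ signConfig ℓ δ =
      signConfig ℓ δ ∘ fun ξ : (zdGraph 2).edgeSet → ℝ => ξ ∘ τ.symm :=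
    funext fun ξ => inv_act_signConfig ℓ δ g hadj hiso τ hτ ξ
  have hnoise : latticeWhiteNoise.map (fun ξ : (zdGraph 2).edgeSet → ℝ => ξ ∘ τ.symm) =
      latticeWhiteNoise :=
    Measure.map_infinitePi_infinitePi_of_inj
      (P := fun _ : (zdGraph 2).edgeSet => gaussianReal 0 1) τ.symm.injective
  rw [signConfigLaw, Measure.map_map (KST2023.act g).measurable (measurable_signConfig ℓ δ), hcomp,
    ← Measure.map_map (measurable_signConfig ℓ δ) hmeas, hnoise]

/-! ### The three generators move medial points isometrically -/

/-- Translations move medial points isometrically (they translate them by `δ v`,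
`medialPoint_map_shift`). -/
theorem inv_norm_medialPoint_map_shift (δ : ℝ) (v : Site 2) (e e' : Sym2 (Site 2)) :
    ‖medialPoint δ (Sym2.map (Site.shift v) e) - medialPoint δ (Sym2.map (Site.shift v) e')‖ =
      ‖medialPoint δ e - medialPoint δ e'‖ := by
  rw [medialPoint_map_shift, medialPoint_map_shift, add_sub_add_right_eq_sub]

/-- The transposition `(x₀, x₁) ↦ (x₁, x₀)` moves medial points by `z ↦ i z̄`. -/
theorem inv_medialPoint_map_transpose (δ : ℝ) (e : Sym2 (Site 2)) :
    medialPoint δ (Sym2.map KSTPeriodic.transposeEquiv e) = Complex.I * conj (medialPoint δ e) := by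
  induction e using Sym2.ind with
  | h x y =>
    refine Complex.ext ?_ ?_ <;>
      simp only [Sym2.map_mk, medialPoint_mk, KSTPeriodic.transposeEquiv_apply, Complex.div_ofNat_re,
        Complex.div_ofNat_im, Complex.add_re, Complex.add_im, meshPoint_re, meshPoint_im,
        Matrix.cons_val_zero, Matrix.cons_val_one, Matrix.cons_val_fin_one, Complex.mul_re,
        Complex.mul_im, Complex.I_re, Complex.I_im, Complex.conj_re, Complex.conj_im] <;>
      ring

/-- The transposition moves medial points isometrically. -/
theorem inv_norm_medialPoint_map_transpose (δ : ℝ) (e e' : Sym2 (Site 2)) :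
    ‖medialPoint δ (Sym2.map KSTPeriodic.transposeEquiv e) -
        medialPoint δ (Sym2.map KSTPeriodic.transposeEquiv e')‖ =
      ‖medialPoint δ e - medialPoint δ e'‖ := by
  rw [inv_medialPoint_map_transpose, inv_medialPoint_map_transpose, ← mul_sub, ← map_sub, norm_mul,
    Complex.norm_I, one_mul, Complex.norm_conj]

/-- The reflection `x ↦ (−t − x₀, x₁)` moves medial points by `z ↦ −z̄ − δ t`. -/
theorem inv_medialPoint_map_flip (δ : ℝ) (t : ℕ) (e : Sym2 (Site 2)) :
    medialPoint δ (Sym2.map (KSTPeriodic.flipEquiv t) e) = -conj (medialPoint δ e) - δ * t := by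
  induction e using Sym2.ind with
  | h x y =>
    refine Complex.ext ?_ ?_ <;>
      simp only [Sym2.map_mk, medialPoint_mk, KSTPeriodic.flipEquiv_apply, Complex.div_ofNat_re,
        Complex.div_ofNat_im, Complex.add_re, Complex.add_im, Complex.sub_re, Complex.sub_im,
        Complex.neg_re, Complex.neg_im, meshPoint_re, meshPoint_im,
        Matrix.cons_val_zero, Matrix.cons_val_one, Matrix.cons_val_fin_one, Complex.mul_re,
        Complex.mul_im, Complex.ofReal_re, Complex.ofReal_im, Complex.natCast_re, Complex.natCast_im,
        Complex.conj_re, Complex.conj_im, Int.cast_sub, Int.cast_neg, Int.cast_natCast] <;>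
      ring

/-- The reflections move medial points isometrically. -/
theorem inv_norm_medialPoint_map_flip (δ : ℝ) (t : ℕ) (e e' : Sym2 (Site 2)) :
    ‖medialPoint δ (Sym2.map (KSTPeriodic.flipEquiv t) e) -
        medialPoint δ (Sym2.map (KSTPeriodic.flipEquiv t) e')‖ =
      ‖medialPoint δ e - medialPoint δ e'‖ := by
  have key : ∀ a b c : ℂ, -a - c - (-b - c) = -(a - b) := fun a b c => by ring
  rw [inv_medialPoint_map_flip, inv_medialPoint_map_flip, key, ← map_sub, norm_neg, Complex.norm_conj]

/-! ### The stub -/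

/-- **Stub S12 — lattice symmetries of the sign law.** For `σ > 0` the law `signConfigLaw σ 1` of
the sign configuration `{e | (k_σ ⋆ ξ)(m_1 e) > 0}` of the Gaussian-smoothed lattice white noise is
invariant under every translation of `ℤ²`, under the transposition `(x₀, x₁) ↦ (x₁, x₀)` and under
the reflection `x ↦ (−x₀, x₁)` (the three generators of `KSTPeriodic.Admissible 1 0` besides
positive association). Each of these maps `g` is induced by an isometry of `ℂ` on medial points, so
`k_σ(m(ge) − m(ge')) = k_σ(m e − m e')`, and relabelling the i.i.d. noise `ξ ↦ ξ ∘ ĝ⁻¹` preserves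
`latticeWhiteNoise`; hence `signConfig σ 1 (ξ ∘ ĝ⁻¹) = g • signConfig σ 1 ξ` pointwise (summable
or not) and the laws agree (`inv_signConfigLaw_map_act`). The hypothesis `0 < σ` is not needed. -/
theorem stub_signLawInvariant :
    ∀ σ : ℝ, 0 < σ →
      (∀ v : Literature.Probability.LatticeModels.Site 2,
        (Literature.Probability.Percolation.signConfigLaw σ 1).map
            (Literature.Probability.Percolation.KST2023.act
              (Literature.Probability.LatticeModels.Site.shift v)) =
          Literature.Probability.Percolation.signConfigLaw σ 1) ∧
      (Literature.Probability.Percolation.signConfigLaw σ 1).map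
          (Literature.Probability.Percolation.KST2023.act
            Literature.Probability.Percolation.KSTPeriodic.transposeEquiv) =
        Literature.Probability.Percolation.signConfigLaw σ 1 ∧
      (Literature.Probability.Percolation.signConfigLaw σ 1).map
          (Literature.Probability.Percolation.KST2023.act
            (Literature.Probability.Percolation.KSTPeriodic.flipEquiv 0)) =
        Literature.Probability.Percolation.signConfigLaw σ 1 :=
  fun σ _ =>
    ⟨fun v => inv_signConfigLaw_map_act σ 1 (Site.shift v) (zdGraph_adj_shift_iff v)
        (inv_norm_medialPoint_map_shift 1 v),
      inv_signConfigLaw_map_act σ 1 KSTPeriodic.transposeEquiv KSTPeriodic.transposeEquiv_adj_iff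
        (inv_norm_medialPoint_map_transpose 1),
      inv_signConfigLaw_map_act σ 1 (KSTPeriodic.flipEquiv 0) (KSTPeriodic.flipEquiv_adj_iff 0)
        (inv_norm_medialPoint_map_flip 1 0)⟩

end Summit.CriticalPhenomena.CardyFormulaZ2.Cruxes.DriftBound.Birth

end
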